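import Summits.KontsevichZagierPeriods.KontsevichZagierPeriods.Theorems.RootDecompWalshStrataBall4Rung
import Summits.KontsevichZagierPeriods.KontsevichZagierPeriods.Theorems.RootDecompWalshStrataParab4Descent

/-!
# `QuadricFour` rung: the solid paraboloid is a second instance of `QuadricTwoDescentFour`

Route `RootDecompWalshStrata` (cell decomp-kz, lens 4, gen 11).  Plugs the proved paraboloid descent
(`Parab4.parab4_twoDescent`, parts `RootDecompWalshStrataParab4{Band,Chart,Descent}`) into the typed node
of `RootDecompWalshStrataQuadricFourRung` / `…Ball4Rung`: `quadricTwoDescentFourAt_parab4 :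
QuadricTwoDescentFourAt parab4Poly` — after the unit 4-ball (`quadricTwoDescentFourAt_ball4`, weight 2,
value `q·π²/32`) a second affine type of quadric 4-cell (rank-3 quadratic part plus a linear term, weight 1,
value `q·π/15`) is decided inside the rules by the same chart-and-descend template.  0 sorry.
[KontsevichZagier2001 §1.2]
-/

namespace Summit.KontsevichZagierPeriods.RootDecompWalshStrata.QuadricFourRung

open Literature.NumberTheory.Transcendental
open Summit.KontsevichZagierPeriods.RootDecompWalshStrata.Parab4 (parab4Poly parab4_twoDescent)

/-- `deg (x₃ − x₀² − x₁² − x₂²) ≤ 2`. [folklore] -/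
theorem totalDegree_parab4Poly_le : parab4Poly.totalDegree ≤ 2 := by
  unfold parab4Poly
  refine (MvPolynomial.totalDegree_sub _ _).trans (max_le ?_ ?_)
  · refine (MvPolynomial.totalDegree_sub _ _).trans (max_le ?_ ?_)
    · refine (MvPolynomial.totalDegree_sub _ _).trans (max_le ?_ ?_)
      · simp [MvPolynomial.totalDegree_X]
      · simp [MvPolynomial.totalDegree_X_pow]
    · simp [MvPolynomial.totalDegree_X_pow]
  · simp [MvPolynomial.totalDegree_X_pow]

/-- **Second specimen of generation 11:** the slice of `QuadricTwoDescentFour` at the solid paraboloid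
`x₃ > x₀² + x₁² + x₂²` holds — decided inside the three KZ rules (`Parab4.parab4_twoDescent`).
[KontsevichZagier2001 §1.2; this node] -/
theorem quadricTwoDescentFourAt_parab4 : QuadricTwoDescentFourAt parab4Poly :=
  fun q ρ hρ _ => parab4_twoDescent q ρ hρ

end Summit.KontsevichZagierPeriods.RootDecompWalshStrata.QuadricFourRung
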